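import Mathlib
import Literature.NumberTheory.LFunctions.Zhang2022.Section12Ded1217
import Literature.NumberTheory.LFunctions.Zhang2022.SkeletonEval97cL102Rel
import HarnessLib

/-!
# Zhang (2022) §12 p. 68: "By (12.7) and (12.8) we obtain `Ξ₁₅ = ΣΣ𝔠*H̄₁₆H₂ω + o(𝔓)`" — the deduction, by Cauchy's inequality, in the RELATIVE reading; (12.17)ᴿ from (12.6), (12.8) and the §12 range claims

Topic `Literature/NumberTheory/LFunctions/Zhang2022` (Landau–Siegel audit tree; verdict-neutral).
Y. Zhang, *Discrete mean estimates and the Landau–Siegel zero*, arXiv:2211.02515v1 (2022)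
[Zhang2022LandauSiegel]. **Status of the source: an unrefereed manuscript under adjudication** (ZHANG-L
discharge lane, WP12; v19 leaf `hXi : Typed.Sec12A.Xi15Hbar16 c′`, typed DED node `Typed.Sec12A.Ded1214`,
GAP rows G-d42-2, G-d42-3). Everything in this file is PROVED (theorems only; no definitions, no new named fact);
nothing here is a claim about Theorems 1–2 of the source or about Landau–Siegel zeros.

**What is kernel-checked.**

* `norm_xi15_sub_via_sq_le` — **Cauchy's inequality behind the sentence** (p. 68, tex L3448; the same
  passage as §11 p. 62 / `Skeleton.prop26_of_evals`): at a modulus where `𝔠*(ρ,ψ) ≥ 0` is real (Lemma 2.3),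
  `ω(ρ) > 0` is real and `|Z(ρ,ψχ)| = 1` (Prop. 2.2 (i), `ψχ` primitive),
  `‖Ξ₁₅ − ΣΣ𝔠*H̄₁₆(1−ρ,ψ̄)H₂(ρ,ψ)ω‖² ≤ (2·ms₁₂.₆ + 2·ms₁₂.₈)·Ξ₁₂`, where `ms₁₂.₆`, `ms₁₂.₈` are the left sides of
  (12.6) and (12.8) (`Typed.Sec12A.ms126/ms128`) and `Ξ₁₂ = ΣΣ𝔠*|H₂|²ω` ((8.4)); pointwise
  `Z⁻¹H₁₅ − H̄₁₆ = Z⁻¹(H₁₅ − H̃₁₅) + (Z⁻¹H̃₁₅ − H̄₁₆)`.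
* `xi15Hbar16_rel_of_eq126_eq128` — **the deduction "(12.6) + (12.8) ⇒ display of p. 68" in the RELATIVE
  reading**: `Prop22i → Lemma23 c′ → Eval97With c′ k → Eq126 c′ → Eq128 c′ →` (`∀ ε > 0`, eventually, under
  (A)) `‖Ξ₁₅ − ΣΣ𝔠*H̄₁₆H₂ω‖ ≤ ε(𝔞+1)𝔓`. The inputs (12.6), (12.8) are `o(𝔞𝔓)` and `Ξ₁₂ ≪ (𝔞+1)𝔓` ((9.7), any
  value `k` of `𝔠₂`), so Cauchy gives `o((𝔞+1)𝔓)` — NOT the printed (and typed, `Xi15Hbar16`) `o(𝔓)`, which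
  would need `𝔞 ≪ 1` under (A), a size input neither printed nor in the tree (only `𝔞 ≪ 𝓛⁴`,
  `Sec12D.frakA_le_ell_pow_four`, and `𝔞 ≫ 1`, Lemma 5.7). This is the §12 member of the absolute-vs-relative
  family already adjudicated for §§15–17 (`SkeletonEvalRel`: (15.24)ᴿ, (16.17)ᴿ, (17.10)ᴿ, G-d49-1/G-d58-1),
  and harmless downstream for the same reason: every consumer compares at the scale `𝔞𝔓`.
* `xi15Hbar16_rel_of_xi15Hbar16` — the typed absolute leaf implies the relative statement (so a re-thread
  `hXi ↦` relative form is a WEAKENING).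
* `eq129_rel_of_xi15_rel` — "(12.9) by Lemma 8.1" (`Sec12D.ded129_holds`) re-run on the relative display:
  `Lemma81 c′ →` relative display `→` (12.9)ᴿ (error `ε(𝔞+1)𝔓`).
* `eval1217Rel_of_rel129` — the §12 top chain (`Sec12D.eval1217_core`: Prop. 7.1, (12.9), (12.15), (12.16),
  `E(·,·) = o(𝔓)`) re-run on (12.9)ᴿ, concluding the banked RELATIVE node `Skeleton.Eval1217Rel c′` (the only
  form of (12.17) the §18 assembly consumes, `Skeleton.eval181Rel_of_parts`).
* `eval1217Rel_of_eq126_eq128` — the composite: `Prop22i → Lemma23 c′ → Prop71 c′ → Lemma81 c′ →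
  Eval97With c′ k → Eq126 c′ → Eq128 c′ → Eq1212 c′ → Mid1225 c′ → Eq1214 c′ → Eq1215 c′ → Low1522 c′ →
  Step12u049 c′ → Eq1216 c′ → Eval1217Rel c′`. Inside `Skeleton.theorem1_of_leaves_v19` every input except
  the nine §12 CLAIM nodes is already a term (`h22i`, `h23`, `h71`, `h81`, `h97`), so the skeleton pen MAY (a
  re-type, by zl-lead + referee word) carry `h126 : Eq126 c′`, `h128 : Eq128 c′` — the printed displays
  (12.6), (12.8), existing typed nodes — in place of the leaf `hXi`, whose typed absolute form does not follow
  from its printed inputs. Their own closers are the in-cone `S_j`-smallness statements of G-d42-2 (`hS`,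
  `Typed.Sec12A.eq126_of_sj_small`) and G-d42-3 (`hS′`).

What is NOT asserted: (12.6), (12.8), any §12 range claim, Prop. 7.1, Lemma 8.1, (9.7), or anything about
Theorems 1–2 / Landau–Siegel zeros. No `sorry`; axioms standard.

## References

* Y. Zhang, arXiv:2211.02515v1 (2022), §12 pp. 66–68, (12.5), (12.6), (12.8), display before (12.9), (12.9),
  (12.17) p. 73; §11 p. 62 (the Cauchy passage); §2 Lemma 2.3, Prop. 2.2 (i); §8 (8.4), Lemma 8.1; §9 (9.7).
  [cite: Zhang2022LandauSiegel, §12 (12.6)–(12.9) pp.66–68, (12.17) p.73]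
-/

noncomputable section

open Complex Real ComplexConjugate
open Literature.NumberTheory.LFunctions.Zhang2022
open Literature.NumberTheory.LFunctions.Zhang2022.Skeleton
open Literature.NumberTheory.LFunctions.Zhang2022.Typed.Sec12A
open Literature.NumberTheory.LFunctions.Zhang2022.Typed.Sec12C

namespace Literature.NumberTheory.LFunctions.Zhang2022.Sec12D

/-! ## Cauchy's inequality at a fixed modulus -/

section Cauchy

variable {c' : ℝ} {D : ℕ} [NeZero D] (χ : DirichletCharacter ℂ D)

/-- A complex number with zero imaginary part and non-negative real part has norm equal to its real part.
[folklore] -/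
private theorem norm_eq_re_of_im_eq_zero {z : ℂ} (him : z.im = 0) (hre : 0 ≤ z.re) : ‖z‖ = z.re := by
  have hz : z = (z.re : ℂ) := Complex.ext (by simp) (by simp [him])
  rw [hz, Complex.norm_real, Real.norm_of_nonneg hre, Complex.ofReal_re]

/-- `(a + b)² ≤ 2a² + 2b²`. [folklore] -/
private theorem add_sq_le_two (a b : ℝ) : (a + b) ^ 2 ≤ 2 * a ^ 2 + 2 * b ^ 2 := by
  nlinarith [sq_nonneg (a - b)]

/-- **Cauchy's inequality behind "By (12.7) and (12.8) we obtain `Ξ₁₅ = ΣΣ𝔠*H̄₁₆H₂ω + o(𝔓)`"** (p. 68, tex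
L3448), at a modulus where the weights `𝔠*(ρ,ψ)ω(ρ)` are real and non-negative and `|Z(ρ,ψχ)| = 1`:
`‖Ξ₁₅ − ΣΣ𝔠*H̄₁₆(1−ρ,ψ̄)H₂(ρ,ψ)ω‖² ≤ (2·ms₁₂.₆ + 2·ms₁₂.₈)·Ξ₁₂`, with
`Z⁻¹H₁₅H₂ − H̄₁₆H₂ = H₂·(Z⁻¹(H₁₅ − H̃₁₅) + (Z⁻¹H̃₁₅ − H̄₁₆))`. [cite: Zhang2022LandauSiegel, §12 (12.9) p.68, tex L3448] -/
theorem norm_xi15_sub_via_sq_le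
    (hc : ∀ i ∈ idx χ, (cstar c' D i.1 i.2).im = 0 ∧ 0 ≤ (cstar c' D i.1 i.2).re)
    (hω : ∀ i ∈ idx χ, 0 < (omegaW D i.2).re ∧ (omegaW D i.2).im = 0)
    (hZ : ∀ i ∈ idx χ, ‖Zpc χ i.1 i.2‖ = 1) :
    ‖xi15 c' χ - xi15viaHbar16 c' χ‖ ^ 2 ≤ (2 * ms126 c' χ + 2 * ms128 c' χ) * xi12 c' χ := by
  -- notation: weights `w i = Re 𝔠* · Re ω ≥ 0`, `d i = ‖Z⁻¹H₁₅ − H̄₁₆(1−ρ)‖`, `h i = ‖H₂‖`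
  set w : ((_ : Chr D) × ℂ) → ℝ := fun i => (cstar c' D i.1 i.2).re * (omegaW D i.2).re with hw_def
  set d : ((_ : Chr D) × ℂ) → ℝ := fun i =>
    ‖(Zpc χ i.1 i.2)⁻¹ * H15 χ i.1 i.2 - Hbar16 χ i.1 (1 - i.2)‖ with hd_def
  set h : ((_ : Chr D) × ℂ) → ℝ := fun i => ‖H2 χ i.1 i.2‖ with hh_def
  have hw : ∀ i ∈ idx χ, 0 ≤ w i := fun i hi => mul_nonneg (hc i hi).2 (hω i hi).1.le
  -- Step 1: the triangle inequality, `‖Ξ₁₅ − via‖ ≤ Σ w·h·d`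
  have step1 : ‖xi15 c' χ - xi15viaHbar16 c' χ‖ ≤ ∑ i ∈ idx χ, w i * h i * d i := by
    rw [xi15, xi15viaHbar16, ← Finset.sum_sub_distrib]
    refine (norm_sum_le _ _).trans (Finset.sum_le_sum fun i hi => ?_)
    have e : cstar c' D i.1 i.2 * (Zpc χ i.1 i.2)⁻¹ * (H15 χ i.1 i.2 * H2 χ i.1 i.2) * omegaW D i.2 -
        cstar c' D i.1 i.2 * Hbar16 χ i.1 (1 - i.2) * H2 χ i.1 i.2 * omegaW D i.2 =
        cstar c' D i.1 i.2 * omegaW D i.2 * H2 χ i.1 i.2 *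
          ((Zpc χ i.1 i.2)⁻¹ * H15 χ i.1 i.2 - Hbar16 χ i.1 (1 - i.2)) := by ring
    rw [e, norm_mul, norm_mul, norm_mul, norm_eq_re_of_im_eq_zero (hc i hi).1 (hc i hi).2,
      norm_eq_re_of_im_eq_zero (hω i hi).2 (hω i hi).1.le]
  -- Step 2: Cauchy, `(Σ w·h·d)² ≤ (Σ w·d²)(Σ w·h²)`
  have step2 : (∑ i ∈ idx χ, w i * h i * d i) ^ 2 ≤
      (∑ i ∈ idx χ, w i * d i ^ 2) * (∑ i ∈ idx χ, w i * h i ^ 2) := by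
    have key := Finset.sum_mul_sq_le_sq_mul_sq (idx χ)
      (fun i => Real.sqrt (w i) * d i) (fun i => Real.sqrt (w i) * h i)
    have e1 : ∀ i ∈ idx χ, Real.sqrt (w i) * d i * (Real.sqrt (w i) * h i) = w i * h i * d i := by
      intro i hi
      have hs := Real.mul_self_sqrt (hw i hi)
      linear_combination (h i * d i) * hs
    have e2 : ∀ i ∈ idx χ, (Real.sqrt (w i) * d i) ^ 2 = w i * d i ^ 2 := by
      intro i hi
      rw [mul_pow, Real.sq_sqrt (hw i hi)]
    have e3 : ∀ i ∈ idx χ, (Real.sqrt (w i) * h i) ^ 2 = w i * h i ^ 2 := by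
      intro i hi
      rw [mul_pow, Real.sq_sqrt (hw i hi)]
    rwa [Finset.sum_congr rfl e1, Finset.sum_congr rfl e2, Finset.sum_congr rfl e3] at key
  -- Step 3: pointwise `d² ≤ 2‖H₁₅ − H̃₁₅‖² + 2‖Z⁻¹H̃₁₅ − H̄₁₆‖²` (`|Z| = 1`)
  have step3 : ∑ i ∈ idx χ, w i * d i ^ 2 ≤ 2 * ms126 c' χ + 2 * ms128 c' χ := by
    rw [ms126, ms128, Finset.mul_sum, Finset.mul_sum, ← Finset.sum_add_distrib]
    refine Finset.sum_le_sum fun i hi => ?_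
    have hdi : d i ≤ ‖H15 χ i.1 i.2 - Htilde15 χ i.1 i.2‖ +
        ‖(Zpc χ i.1 i.2)⁻¹ * Htilde15 χ i.1 i.2 - Hbar16 χ i.1 (1 - i.2)‖ := by
      have e : (Zpc χ i.1 i.2)⁻¹ * H15 χ i.1 i.2 - Hbar16 χ i.1 (1 - i.2) =
          (Zpc χ i.1 i.2)⁻¹ * (H15 χ i.1 i.2 - Htilde15 χ i.1 i.2) +
            ((Zpc χ i.1 i.2)⁻¹ * Htilde15 χ i.1 i.2 - Hbar16 χ i.1 (1 - i.2)) := by ring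
      simp only [hd_def]
      rw [e]
      refine (norm_add_le _ _).trans (le_of_eq ?_)
      rw [norm_mul, norm_inv, hZ i hi, inv_one, one_mul]
    have hd0 : 0 ≤ d i := norm_nonneg _
    have hsq : d i ^ 2 ≤ 2 * ‖H15 χ i.1 i.2 - Htilde15 χ i.1 i.2‖ ^ 2 +
        2 * ‖(Zpc χ i.1 i.2)⁻¹ * Htilde15 χ i.1 i.2 - Hbar16 χ i.1 (1 - i.2)‖ ^ 2 :=
      (pow_le_pow_left₀ hd0 hdi 2).trans (add_sq_le_two _ _)
    have := mul_le_mul_of_nonneg_left hsq (hw i hi)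
    simp only [hw_def] at this ⊢
    nlinarith [this]
  -- Step 4: `Σ w·h² = Ξ₁₂`
  have step4 : ∑ i ∈ idx χ, w i * h i ^ 2 = xi12 c' χ := by
    rw [xi12]
    refine Finset.sum_congr rfl fun i _ => ?_
    simp only [hw_def, hh_def]
    ring
  have h12 : 0 ≤ xi12 c' χ := by
    rw [← step4]
    exact Finset.sum_nonneg fun i hi => mul_nonneg (hw i hi) (sq_nonneg _)
  have hT0 : 0 ≤ ∑ i ∈ idx χ, w i * h i * d i :=
    Finset.sum_nonneg fun i hi => mul_nonneg (mul_nonneg (hw i hi) (norm_nonneg _)) (norm_nonneg _)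
  calc ‖xi15 c' χ - xi15viaHbar16 c' χ‖ ^ 2 ≤ (∑ i ∈ idx χ, w i * h i * d i) ^ 2 :=
        pow_le_pow_left₀ (norm_nonneg _) step1 2
    _ ≤ (∑ i ∈ idx χ, w i * d i ^ 2) * (∑ i ∈ idx χ, w i * h i ^ 2) := step2
    _ ≤ (2 * ms126 c' χ + 2 * ms128 c' χ) * xi12 c' χ := by
        rw [step4]
        exact mul_le_mul_of_nonneg_right step3 h12

end Cauchy

/-! ## The deduction in the relative reading -/

section Relative

variable (c' : ℝ)

/-- **"By (12.7) and (12.8) we obtain `Ξ₁₅ = ΣΣ𝔠*H̄₁₆(1−ρ,ψ̄)H₂(ρ,ψ)ω(ρ) + o(𝔓)`" (p. 68, tex L3448) HOLDS IN THE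
RELATIVE READING**: from (12.6) and (12.8) (both `o(𝔞𝔓)`, `Typed.Sec12A.Eq126/Eq128`), `Ξ₁₂ = k𝔞𝔓 + o(𝔓)`
((9.7) with any value `k` of `𝔠₂`, `Skeleton.Eval97With`), Lemma 2.3 and Prop. 2.2 (i) (`𝔠*ω ≥ 0` real,
`|Z(ρ,ψχ)| = 1`; `ψχ` primitive is the tree's `psiChiPrimitive_holds`), Cauchy's inequality
(`norm_xi15_sub_via_sq_le`) gives `‖Ξ₁₅ − ΣΣ𝔠*H̄₁₆H₂ω‖ ≤ ε(𝔞+1)𝔓` eventually, for every `ε > 0`. The printed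
`o(𝔓)` (typed `Xi15Hbar16`) would need in addition `𝔞 ≪ 1` under (A), which is not in print.
[cite: Zhang2022LandauSiegel, §12 (12.9) p.68, tex L3448] -/
theorem xi15Hbar16_rel_of_eq126_eq128 (h22 : Prop22i) (h23 : Lemma23 c') {k : ℝ} (h97 : Eval97With c' k)
    (h126 : Eq126 c') (h128 : Eq128 c') :
    ∀ ε : ℝ, 0 < ε → ForAllLarge fun D _ χ => AssumptionA D χ →
      ‖xi15 c' χ - xi15viaHbar16 c' χ‖ ≤ ε * (frakA χ + 1) * frakP D := by
  intro ε hε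
  -- constants: `Ξ₁₂ ≤ K(𝔞+1)𝔓` with `K = |k| + 1`, and `ε₁ = ε²/(4K)` for (12.6), (12.8)
  set K : ℝ := |k| + 1 with hK
  have hK0 : 0 < K := by positivity
  set ε₁ : ℝ := ε ^ 2 / (4 * K) with hε₁
  have hε₁0 : 0 < ε₁ := by positivity
  obtain ⟨D₀, hall⟩ := (((h22.and h23).and (h126 ε₁ hε₁0)).and (h128 ε₁ hε₁0)).and (h97 1 one_pos)
  refine ⟨max D₀ 3, fun D _ χ hD hq hp hA => ?_⟩
  have hD3 : 3 ≤ D := le_trans (le_max_right _ _) hD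
  obtain ⟨⟨⟨⟨h22', h23'⟩, h126'⟩, h128'⟩, h97'⟩ := hall D χ (le_trans (le_max_left _ _) hD) hq hp
  obtain ⟨hc, hω, hZ⟩ :=
    pointwise_inputs c' χ hD3 h23' h22' (fun x => psiChiPrimitive_holds D χ x hD3 hp)
  have hP := frakP_nonneg D
  have hAf := frakA_nonneg χ
  set X : ℝ := (frakA χ + 1) * frakP D with hX
  have hX0 : 0 ≤ X := by positivity
  -- the three mean-value inputs at this modulus
  have e126 : ms126 c' χ ≤ ε₁ * X := by
    have := (abs_le.mp (h126' hA)).2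
    rw [hX]; nlinarith [mul_nonneg (mul_nonneg hε₁0.le hP) (le_refl (0:ℝ)), mul_nonneg hε₁0.le hP]
  have e128 : ms128 c' χ ≤ ε₁ * X := by
    have := (abs_le.mp (h128' hA)).2
    rw [hX]; nlinarith [mul_nonneg hε₁0.le hP]
  have e12 : xi12 c' χ ≤ K * X := by
    have e2 := (abs_le.mp (h97' hA)).2
    have : k * frakA χ * frakP D ≤ |k| * frakA χ * frakP D := by
      have := mul_le_mul_of_nonneg_right (le_abs_self k) (mul_nonneg hAf hP)
      nlinarith
    rw [hK, hX]
    nlinarith [mul_nonneg hAf hP, mul_nonneg (abs_nonneg k) hP]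
  -- Cauchy
  have hcs := norm_xi15_sub_via_sq_le (c' := c') χ hc hω hZ
  have h12nonneg : 0 ≤ xi12 c' χ := by
    rw [xi12]
    exact Finset.sum_nonneg fun i hi =>
      mul_nonneg (mul_nonneg (hc i hi).2 (by positivity)) (hω i hi).1.le
  have hms0 : 0 ≤ 2 * ms126 c' χ + 2 * ms128 c' χ := by
    rw [ms126, ms128]
    have h1 := Finset.sum_nonneg (s := idx χ) fun i hi =>
      mul_nonneg (mul_nonneg (hc i hi).2 (sq_nonneg ‖H15 χ i.1 i.2 - Htilde15 χ i.1 i.2‖))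
        (hω i hi).1.le
    have h2 := Finset.sum_nonneg (s := idx χ) fun i hi =>
      mul_nonneg (mul_nonneg (hc i hi).2
        (sq_nonneg ‖(Zpc χ i.1 i.2)⁻¹ * Htilde15 χ i.1 i.2 - Hbar16 χ i.1 (1 - i.2)‖)) (hω i hi).1.le
    linarith
  have hprod : (2 * ms126 c' χ + 2 * ms128 c' χ) * xi12 c' χ ≤ (4 * ε₁ * X) * (K * X) :=
    mul_le_mul (by linarith) e12 h12nonneg (by positivity)
  have hεX : (4 * ε₁ * X) * (K * X) = (ε * X) ^ 2 := by
    rw [hε₁]; field_simp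
  have hsq2 : ‖xi15 c' χ - xi15viaHbar16 c' χ‖ ^ 2 ≤ (ε * X) ^ 2 := hcs.trans (hεX ▸ hprod)
  have hfin : ‖xi15 c' χ - xi15viaHbar16 c' χ‖ ≤ ε * X :=
    (pow_le_pow_iff_left₀ (norm_nonneg _) (by positivity) two_ne_zero).mp hsq2
  simpa [hX, mul_assoc] using hfin

/-- **The typed absolute leaf implies the relative statement** (an `ε𝔓` bound is an `ε(𝔞+1)𝔓` bound): a
re-thread of `hXi : Xi15Hbar16 c′` onto the relative display is a WEAKENING of that hypothesis.
[cite: Zhang2022LandauSiegel, §12 (12.9) p.68] -/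
theorem xi15Hbar16_rel_of_xi15Hbar16 (hXi : Xi15Hbar16 c') :
    ∀ ε : ℝ, 0 < ε → ForAllLarge fun D _ χ => AssumptionA D χ →
      ‖xi15 c' χ - xi15viaHbar16 c' χ‖ ≤ ε * (frakA χ + 1) * frakP D := fun ε hε =>
  (hXi ε hε).mono fun D _ χ _ _ hS hA => by
    have := hS hA
    nlinarith [mul_nonneg (mul_nonneg hε.le (frakA_nonneg χ)) (frakP_nonneg D)]

/-- **"This implies, by Lemma 8.1, (12.9)" (p. 68, tex L3452) on the relative display**: Lemma 8.1 at
`(𝐚₁₂, 𝐚₂₅)` (admissible, `adm72_a12`/`adm72_a25`), `ΣΣ𝔠*H̄₁₆H₂ω = lhs₈.₁(𝐚₁₂,𝐚₂₅)`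
(`xi15viaHbar16_eq_lhs81`) and `𝐚̄₂₅ = 𝐚₁₅`, `𝐚̄₁₂ = 𝐚₂₂` give (12.9) with error `ε(𝔞+1)𝔓` — the proof of
`ded129_holds`, verbatim, with the relative input. [cite: Zhang2022LandauSiegel, §12 (12.9) p.68, tex L3452] -/
theorem eq129_rel_of_xi15_rel (h81 : Lemma81 c')
    (hXi : ∀ ε : ℝ, 0 < ε → ForAllLarge fun D _ χ => AssumptionA D χ →
      ‖xi15 c' χ - xi15viaHbar16 c' χ‖ ≤ ε * (frakA χ + 1) * frakP D) :
    ∀ ε : ℝ, 0 < ε → ForAllLarge fun D _ χ => AssumptionA D χ →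
      ‖xi15 c' χ - (Theta1 c' χ (a12 χ) (a25 χ) + conj (Theta1 c' χ (a15 χ) (a22 χ)))‖ ≤
        ε * (frakA χ + 1) * frakP D := by
  intro ε hε
  set B := max (‖iota3‖ + ‖iota4‖) 1 with hB
  obtain ⟨D₀, h⟩ := ((hXi (ε / 2) (by positivity)).and (h81 B (ε / 2) (by positivity))).and
    (forAllLarge_log_ge 3)
  refine ⟨D₀, fun D _ χ hD hq hp hA => ?_⟩
  obtain ⟨⟨hXiD, h81D⟩, hlog3⟩ := h D χ hD hq hp
  have hlog2 : 2 ≤ Real.log D := by linarith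
  have adm12 : Adm72 D B (a12 χ) := adm72_mono (le_max_left _ _) (adm72_a12 χ hlog2)
  have adm25 : Adm72 D B (a25 χ) := adm72_mono (le_max_right _ _) (adm72_a25 χ hlog3)
  have key := h81D hA (a12 χ) (a25 χ) adm12 adm25
  have e1 : (fun n => conj (a25 χ n)) = a15 χ := funext fun n => by rw [a25, Complex.conj_conj]
  have e2 : (fun n => conj (a12 χ n)) = a22 χ := funext fun n => rfl
  rw [e1, e2, ← xi15viaHbar16_eq_lhs81 c' χ hlog3 hq] at key
  have h1 := hXiD hA
  have hP := frakP_nonneg D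
  have hAf := frakA_nonneg χ
  calc ‖xi15 c' χ - (Theta1 c' χ (a12 χ) (a25 χ) + conj (Theta1 c' χ (a15 χ) (a22 χ)))‖
      ≤ ‖xi15 c' χ - xi15viaHbar16 c' χ‖ +
          ‖xi15viaHbar16 c' χ - (Theta1 c' χ (a12 χ) (a25 χ) + conj (Theta1 c' χ (a15 χ) (a22 χ)))‖ :=
        norm_sub_le_norm_sub_add_norm_sub _ _ _
    _ ≤ ε / 2 * (frakA χ + 1) * frakP D + ε / 2 * frakP D := add_le_add h1 key
    _ ≤ ε * (frakA χ + 1) * frakP D := by nlinarith [mul_nonneg (mul_nonneg hε.le hAf) hP]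

/-- `|C|·(η/(|C|+1)) ≤ η` for `η ≥ 0`. [folklore] -/
private theorem abs_mul_div_succ_le' (C : ℝ) {η : ℝ} (hη : 0 ≤ η) : |C| * (η / (|C| + 1)) ≤ η := by
  have h1 : 0 < |C| + 1 := by positivity
  rw [mul_div_assoc', div_le_iff₀ h1]
  nlinarith [abs_nonneg C]

/-- **(12.17)ᴿ from Proposition 7.1, (12.9)ᴿ, (12.15), (12.16) and the negligibility of the two error terms**
— `Sec12D.eval1217_core` re-run with the relative (12.9): `‖Ξ₁₅ − (e₁* + 2e₂*)𝔞𝔓‖ ≤ 10⁻⁵𝔞𝔓 + ε(𝔞+1)𝔓`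
eventually (`Skeleton.Eval1217Rel`; the two printed `ε/2` slacks add to the `ε` of (12.17) exactly as printed).
[cite: Zhang2022LandauSiegel, §12 (12.17) p.73, tex L3713] -/
theorem eval1217Rel_of_rel129 (h71 : Prop71 c')
    (h129 : ∀ ε : ℝ, 0 < ε → ForAllLarge fun D _ χ => AssumptionA D χ →
      ‖xi15 c' χ - (Theta1 c' χ (a12 χ) (a25 χ) + conj (Theta1 c' χ (a15 χ) (a22 χ)))‖ ≤
        ε * (frakA χ + 1) * frakP D)
    (h1215 : Eq1215 c') (h1216 : Eq1216 c')
    (hE1 : ∀ ε : ℝ, 0 < ε → ForAllLarge fun D _ χ => AssumptionA D χ →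
      Ecal c' D (a12 χ) (a25 χ) ≤ ε * frakP D)
    (hE2 : ∀ ε : ℝ, 0 < ε → ForAllLarge fun D _ χ => AssumptionA D χ →
      Ecal c' D (a15 χ) (a22 χ) ≤ ε * frakP D) :
    Eval1217Rel c' := by
  intro ε hε
  set η := ε / 7 with hη
  have hη0 : 0 < η := by positivity
  set B := max (‖iota3‖ + ‖iota4‖) 1 with hB
  obtain ⟨C, h71'⟩ := h71 B η hη0
  have hC1 : 0 < |C| + 1 := by positivity
  obtain ⟨D₀, hall⟩ := (((((h71'.and (h129 η hη0)).and (h1215 η hη0)).and (h1216 η hη0)).and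
    ((hE1 (η / (|C| + 1)) (by positivity)).and (hE2 (η / (|C| + 1)) (by positivity)))).and
    (forAllLarge_log_ge 4))
  refine ⟨D₀, fun D _ χ hD hq hp hA => ?_⟩
  obtain ⟨⟨⟨⟨⟨h71D, h129D⟩, h1215D⟩, h1216D⟩, ⟨hE1D, hE2D⟩⟩, hlog4⟩ := hall D χ hD hq hp
  have hlog2 : 2 ≤ Real.log D := by linarith
  have hlog3 : 3 ≤ Real.log D := by linarith
  have hD1 : 1 ≤ Real.log D := by linarith
  have hP := frakP_nonneg D
  have hAf := frakA_nonneg χ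
  -- admissibility (7.2) of the four sequences, with the common bound `B`
  have adm12 : Adm72 D B (a12 χ) := adm72_mono (le_max_left _ _) (adm72_a12 χ hlog2)
  have adm22 : Adm72 D B (a22 χ) := adm72_mono (le_max_left _ _) (adm72_a22 χ hlog2)
  have adm25 : Adm72 D B (a25 χ) := adm72_mono (le_max_right _ _) (adm72_a25 χ hlog3)
  have adm15 : Adm72 D B (a15 χ) := adm72_mono (le_max_right _ _) (adm72_a15 χ hlog3)
  -- Proposition 7.1 at the two pairs
  have t1 := h71D hA (a12 χ) (a25 χ) adm12 adm25
  have t2 := h71D hA (a15 χ) (a22 χ) adm15 adm22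
  -- (12.15), (12.16)
  have w1 := h1215D hA (a25 χ) (fun n => rfl)
  have w2 := h1216D hA (a15 χ) (fun n => rfl)
  -- the error terms
  have E1 := hE1D hA
  have E2 := hE2D hA
  have hEnn : ∀ a₁ a₂ : ℕ → ℂ, 0 ≤ Ecal c' D a₁ a₂ := fun a₁ a₂ => by
    unfold Ecal; exact mul_nonneg (mul_nonneg hP (sq_nonneg _)) (by positivity)
  have hCη := abs_mul_div_succ_le' C hη0.le
  have s1 := theta1_slack_pt hP (hEnn _ _) t1 (mainMV_eq_weighted c' hD1 (a12 χ) (a25 χ)) w1 E1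
  have s2 := theta1_slack_pt hP (hEnn _ _) t2 (mainMV_eq_weighted c' hD1 (a15 χ) (a22 χ)) w2 E2
  have r := h129D hA
  -- the exact decomposition behind (12.17)
  have key : xi15 c' χ - (e1star + 2 * e2star) * frakA χ * frakP D =
      (xi15 c' χ - (Theta1 c' χ (a12 χ) (a25 χ) + conj (Theta1 c' χ (a15 χ) (a22 χ)))) +
      (Theta1 c' χ (a12 χ) (a25 χ) - (frakA χ : ℂ) * (e1star + e2star) * (frakP D : ℂ)) +
      conj (Theta1 c' χ (a15 χ) (a22 χ) - (frakA χ : ℂ) * conj e2star * (frakP D : ℂ)) := by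
    rw [map_sub, map_mul, map_mul, Complex.conj_ofReal, Complex.conj_ofReal, Complex.conj_conj]
    ring
  rw [key]
  calc ‖(xi15 c' χ - (Theta1 c' χ (a12 χ) (a25 χ) + conj (Theta1 c' χ (a15 χ) (a22 χ)))) +
        (Theta1 c' χ (a12 χ) (a25 χ) - (frakA χ : ℂ) * (e1star + e2star) * (frakP D : ℂ)) +
        conj (Theta1 c' χ (a15 χ) (a22 χ) - (frakA χ : ℂ) * conj e2star * (frakP D : ℂ))‖
      ≤ ‖xi15 c' χ - (Theta1 c' χ (a12 χ) (a25 χ) + conj (Theta1 c' χ (a15 χ) (a22 χ)))‖ +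
        ‖Theta1 c' χ (a12 χ) (a25 χ) - (frakA χ : ℂ) * (e1star + e2star) * (frakP D : ℂ)‖ +
        ‖conj (Theta1 c' χ (a15 χ) (a22 χ) - (frakA χ : ℂ) * conj e2star * (frakP D : ℂ))‖ :=
        norm_add₃_le
    _ = ‖xi15 c' χ - (Theta1 c' χ (a12 χ) (a25 χ) + conj (Theta1 c' χ (a15 χ) (a22 χ)))‖ +
        ‖Theta1 c' χ (a12 χ) (a25 χ) - (frakA χ : ℂ) * (e1star + e2star) * (frakP D : ℂ)‖ +
        ‖Theta1 c' χ (a15 χ) (a22 χ) - (frakA χ : ℂ) * conj e2star * (frakP D : ℂ)‖ := by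
        rw [Complex.norm_conj]
    _ ≤ η * (frakA χ + 1) * frakP D +
        (frakA χ * (1e-5 / 2) * frakP D + (|C| * (η / (|C| + 1)) + η + η) * frakP D) +
        (frakA χ * (1e-5 / 2) * frakP D + (|C| * (η / (|C| + 1)) + η + η) * frakP D) := by
        gcongr
    _ ≤ η * (frakA χ + 1) * frakP D + (frakA χ * (1e-5 / 2) * frakP D + (η + η + η) * frakP D) +
        (frakA χ * (1e-5 / 2) * frakP D + (η + η + η) * frakP D) := by
        gcongr
    _ = 1e-5 * frakA χ * frakP D + (η * (frakA χ + 1) + 6 * η) * frakP D := by ring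
    _ ≤ 1e-5 * frakA χ * frakP D + (7 * η * (frakA χ + 1)) * frakP D := by
        gcongr
        nlinarith [mul_nonneg hη0.le hAf]
    _ = 1e-5 * frakA χ * frakP D + ε * (frakA χ + 1) * frakP D := by rw [hη]; ring

/-- **(12.17)ᴿ from (12.6), (12.8) and the typed §12 range claims** — the composite edge for the skeleton:
`Prop22i → Lemma23 c′ → Prop71 c′ → Lemma81 c′ → Eval97With c′ k → Eq126 c′ → Eq128 c′ → Eq1212 c′ → Mid1225 c′ →
Eq1214 c′ → Eq1215 c′ → Low1522 c′ → Step12u049 c′ → Eq1216 c′ → Skeleton.Eval1217Rel c′` (the display of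
p. 68 by Cauchy in the relative reading, (12.9)ᴿ by Lemma 8.1, the range claims via `ecal_a12_small`,
`ecal_a15_small`, and `eval1217Rel_of_rel129`). Inside `theorem1_of_leaves_v19` every input but the nine §12
CLAIM nodes is already a term. [cite: Zhang2022LandauSiegel, §12 (12.6)–(12.17) pp.66–73] -/
theorem eval1217Rel_of_eq126_eq128 (h22 : Prop22i) (h23 : Lemma23 c') (h71 : Prop71 c') (h81 : Lemma81 c')
    {k : ℝ} (h97 : Eval97With c' k) (h126 : Eq126 c') (h128 : Eq128 c') (h1212 : Eq1212 c')
    (hMid : Mid1225 c') (h1214 : Eq1214 c') (h1215 : Eq1215 c') (hLow : Low1522 c')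
    (h049 : Step12u049 c') (h1216 : Eq1216 c') : Eval1217Rel c' :=
  eval1217Rel_of_rel129 c' h71
    (eq129_rel_of_xi15_rel c' h81 (xi15Hbar16_rel_of_eq126_eq128 c' h22 h23 h97 h126 h128))
    h1215 h1216 (ecal_a12_small c' h1212 hMid h1214) (ecal_a15_small c' hLow h049)

/-- **(12.17)ᴿ from the typed v19 leaves with `hXi` read relatively** — the same chain consuming the relative
display directly (for a re-thread that keeps one §12 display hypothesis in place of `hXi`).
[cite: Zhang2022LandauSiegel, §12 (12.9)–(12.17) pp.68–73] -/
theorem eval1217Rel_of_xi15_rel (h71 : Prop71 c') (h81 : Lemma81 c')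
    (hXi : ∀ ε : ℝ, 0 < ε → ForAllLarge fun D _ χ => AssumptionA D χ →
      ‖xi15 c' χ - xi15viaHbar16 c' χ‖ ≤ ε * (frakA χ + 1) * frakP D)
    (h1212 : Eq1212 c') (hMid : Mid1225 c') (h1214 : Eq1214 c') (h1215 : Eq1215 c')
    (hLow : Low1522 c') (h049 : Step12u049 c') (h1216 : Eq1216 c') : Eval1217Rel c' :=
  eval1217Rel_of_rel129 c' h71 (eq129_rel_of_xi15_rel c' h81 hXi) h1215 h1216
    (ecal_a12_small c' h1212 hMid h1214) (ecal_a15_small c' hLow h049)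

end Relative

end Literature.NumberTheory.LFunctions.Zhang2022.Sec12D
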